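import Mathlib
import HarnessLib

/-!
# Canonical-ensemble occupation sandwich for number-projected pair condensates
(solo-blind programme, Theorem 25)

For nonnegative weights `x : α → ℝ` on a finite set `s` of pair modes, the elementary symmetric
sums
`e_j(s) = ∑_{T ⊆ s, #T = j} ∏_{k ∈ T} x_k`
are the squared norms of the number-projected (AGP / projected-BCS) hard-core pair condensates
with amplitudes `± √x_k`, and the canonical occupation of a mode `a` at pair number `N` in the
mode set `insert a s` is `P_a(N) = x_a · e_{N-1}(s) / e_N(insert a s)`.

Purely by induction on the modes (no analysis, no saddle point) we prove:

* `esy_insert_succ` : the recursion `e_{j+1}(insert a s) = e_{j+1}(s) + x_a e_j(s)`;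
* `esy_mul_esy_le` : STRONG LOG-CONCAVITY `e_i(s) e_{j+2}(s) ≤ e_{i+1}(s) e_{j+1}(s)` for
  `i ≤ j` — Newton's inequality in its coefficient-free form together with the monotonicity
  of the ratios `e_{j+1}/e_j`;
* the OCCUPATION SANDWICH (`occupation_lower_prodForm`, `occupation_upper_prodForm`, and the
  division forms `occupation_ge`, `occupation_le`): `P_a(N)` lies between the grand-canonical
  (independent-mode) occupations `x_a z / (1 + x_a z)` at the two fugacities
  `z₋ = e_{N-1}/e_N ≤ z₊ = e_N/e_{N+1}` of the FULL system `insert a s` — the same two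
  fugacities for every mode `a`.

These are the number-projection estimates needed to run a BCS trial state inside a FIXED
particle-number sector uniformly in the volume (report §5.20 (5), claim C53): they replace the
Darwin–Fowler saddle point by two-sided bounds valid at every finite size.
-/

namespace Summit.HubbardSuperconductivity.HubbardSuperconductivity.Theorems.CanonicalOccupation

open Finset

variable {α : Type*} [DecidableEq α]

/-- `esy[x, s, j]` = the `j`-th elementary symmetric sum of the weights `x` over the modes `s`. -/
local notation "esy[" x ", " s ", " j "]" =>
  (∑ t ∈ Finset.powersetCard j s, ∏ k ∈ t, x k)

omit [DecidableEq α] in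
/-- `e_0 = 1`. [folklore] -/
theorem esy_zero (x : α → ℝ) (s : Finset α) : esy[x, s, 0] = 1 := by
  rw [powersetCard_zero, sum_singleton, prod_empty]

omit [DecidableEq α] in
/-- `e_j(s) = 0` for `j > #s`. [folklore] -/
theorem esy_eq_zero_of_card_lt (x : α → ℝ) {s : Finset α} {j : ℕ} (h : s.card < j) :
    esy[x, s, j] = 0 := by
  rw [powersetCard_eq_empty.2 h, sum_empty]

omit [DecidableEq α] in
/-- `e_j(∅) = 0` for `j ≥ 1`. [folklore] -/
theorem esy_empty_succ (x : α → ℝ) (j : ℕ) : esy[x, (∅ : Finset α), j + 1] = 0 :=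
  esy_eq_zero_of_card_lt x (by simp)

omit [DecidableEq α] in
/-- Nonnegativity. [folklore] -/
theorem esy_nonneg {x : α → ℝ} {s : Finset α} (hx : ∀ k ∈ s, 0 ≤ x k) (j : ℕ) :
    0 ≤ esy[x, s, j] :=
  sum_nonneg fun _ ht => prod_nonneg fun k hk => hx k ((mem_powersetCard.1 ht).1 hk)

/-- The one-mode recursion `e_{j+1}(insert a s) = e_{j+1}(s) + x_a · e_j(s)`. [folklore] -/
theorem esy_insert_succ (x : α → ℝ) {s : Finset α} {a : α} (ha : a ∉ s) (j : ℕ) :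
    esy[x, insert a s, j + 1] = esy[x, s, j + 1] + x a * esy[x, s, j] := by
  rw [powersetCard_succ_insert ha, sum_union, sum_image]
  · congr 1
    rw [mul_sum]
    refine sum_congr rfl fun t ht => ?_
    have hat : a ∉ t := fun h' => ha ((mem_powersetCard.1 ht).1 h')
    rw [prod_insert hat]
  · intro t₁ ht₁ t₂ ht₂ heq
    have h1 : a ∉ t₁ := fun h' => ha ((mem_powersetCard.1 (mem_coe.1 ht₁)).1 h')
    have h2 : a ∉ t₂ := fun h' => ha ((mem_powersetCard.1 (mem_coe.1 ht₂)).1 h')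
    rw [← erase_insert h1, heq, erase_insert h2]
  · rw [disjoint_left]
    intro t ht ht'
    obtain ⟨u, -, rfl⟩ := mem_image.1 ht'
    exact ha ((mem_powersetCard.1 ht).1 (mem_insert_self a u))

/-- `e_0(insert a s) = e_0(s)` (both are `1`). [folklore] -/
theorem esy_insert_zero (x : α → ℝ) (s : Finset α) (a : α) :
    esy[x, insert a s, 0] = esy[x, s, 0] := by
  rw [esy_zero, esy_zero]

/-- STRONG LOG-CONCAVITY of the elementary symmetric sums of nonnegative reals (Newton's
inequality, coefficient-free form, plus monotonicity of the ratios `e_{j+1}/e_j`):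
`e_i · e_{j+2} ≤ e_{i+1} · e_{j+1}` whenever `i ≤ j`.  Proof: induction on the modes; the
insertion of one mode of weight `x ≥ 0` preserves the property since the defect of
`(e_{i+1} + x e_i)(e_{j+3} + x e_{j+2}) ≤ (e_{i+2} + x e_{i+1})(e_{j+2} + x e_{j+1})` is a
nonnegative combination of three instances of the property for `s`. [new: formalisation;
the inequality is classical (Newton 1707)] -/
theorem esy_mul_esy_le {x : α → ℝ} {s : Finset α} (hx : ∀ k ∈ s, 0 ≤ x k) :
    ∀ i j : ℕ, i ≤ j → esy[x, s, i] * esy[x, s, j + 2] ≤ esy[x, s, i + 1] * esy[x, s, j + 1] := by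
  induction s using Finset.induction_on with
  | empty =>
    intro i j _
    rw [esy_empty_succ x (j + 1), esy_empty_succ x j, mul_zero, mul_zero]
  | @insert a s ha ih =>
    have hxs : ∀ k ∈ s, 0 ≤ x k := fun k hk => hx k (mem_insert_of_mem hk)
    have hxa : 0 ≤ x a := hx a (mem_insert_self a s)
    have IH := ih hxs
    have hE : ∀ n, 0 ≤ esy[x, s, n] := esy_nonneg hxs
    intro i j hij
    cases i with
    | zero =>
      -- `C_{j+2} ≤ C_1 · C_{j+1}` with `C_0 = 1`.
      rw [esy_zero, one_mul, esy_insert_succ x ha (j + 1), esy_insert_succ x ha j,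
        esy_insert_succ x ha 0, esy_zero]
      have h1 := IH 0 j (Nat.zero_le j)
      rw [esy_zero, one_mul] at h1
      nlinarith [hE 1, hE j, hE (j + 1), mul_nonneg hxa (hE 1), mul_nonneg hxa (hE j),
        mul_nonneg (mul_nonneg hxa (hE 1)) (hE j), mul_nonneg (mul_nonneg hxa hxa) (hE j)]
    | succ i₀ =>
      obtain ⟨j₀, rfl⟩ : ∃ j₀, j = j₀ + 1 := ⟨j - 1, by omega⟩
      have hi : i₀ ≤ j₀ := by omega
      rw [esy_insert_succ x ha i₀, esy_insert_succ x ha (j₀ + 2), esy_insert_succ x ha (i₀ + 1),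
        esy_insert_succ x ha (j₀ + 1)]
      -- (1) `E_{i₀+1} E_{j₀+3} ≤ E_{i₀+2} E_{j₀+2}`
      have h1 := IH (i₀ + 1) (j₀ + 1) (by omega)
      -- (3) `E_{i₀} E_{j₀+3} ≤ E_{i₀+1} E_{j₀+2} ≤ E_{i₀+2} E_{j₀+1}`
      have h3a := IH i₀ (j₀ + 1) (by omega)
      have h3b : esy[x, s, i₀ + 1] * esy[x, s, j₀ + 2] ≤ esy[x, s, i₀ + 2] * esy[x, s, j₀ + 1] := by
        rcases Nat.eq_or_lt_of_le hi with rfl | hlt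
        · rw [mul_comm]
        · exact IH (i₀ + 1) j₀ hlt
      -- (4) `E_{i₀} E_{j₀+2} ≤ E_{i₀+1} E_{j₀+1}`
      have h4 := IH i₀ j₀ hi
      have h3 : x a * (esy[x, s, i₀] * esy[x, s, j₀ + 1 + 2]) ≤
          x a * (esy[x, s, i₀ + 2] * esy[x, s, j₀ + 1]) :=
        mul_le_mul_of_nonneg_left (h3a.trans h3b) hxa
      have h4' : x a * x a * (esy[x, s, i₀] * esy[x, s, j₀ + 2]) ≤
          x a * x a * (esy[x, s, i₀ + 1] * esy[x, s, j₀ + 1]) :=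
        mul_le_mul_of_nonneg_left h4 (mul_nonneg hxa hxa)
      have e1 : j₀ + 1 + 2 = j₀ + 2 + 1 := by ring
      have e2 : j₀ + 1 + 1 = j₀ + 2 := by ring
      rw [e1] at h1 h3
      rw [e2]
      nlinarith [h1, h3, h4']

/-- Log-concavity `e_j e_{j+2} ≤ e_{j+1}²`. [folklore: Newton's inequality, weak form] -/
theorem esy_mul_esy_le_sq {x : α → ℝ} {s : Finset α} (hx : ∀ k ∈ s, 0 ≤ x k) (j : ℕ) :
    esy[x, s, j] * esy[x, s, j + 2] ≤ esy[x, s, j + 1] ^ 2 := by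
  rw [sq]; exact esy_mul_esy_le hx j j le_rfl

/-- Ratio monotonicity in division form: `e_{j+2}/e_{j+1} ≤ e_{j+1}/e_j` when the
denominators are positive. [folklore] -/
theorem esy_ratio_antitone {x : α → ℝ} {s : Finset α} (hx : ∀ k ∈ s, 0 ≤ x k) (j : ℕ)
    (h0 : 0 < esy[x, s, j]) (h1 : 0 < esy[x, s, j + 1]) :
    esy[x, s, j + 2] / esy[x, s, j + 1] ≤ esy[x, s, j + 1] / esy[x, s, j] := by
  rw [div_le_div_iff₀ h1 h0]
  have := esy_mul_esy_le_sq hx j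
  nlinarith [this]

/-! ## The occupation sandwich

Throughout, `a ∉ s` is the distinguished mode, `E_j = e_j(s)` (the other modes) and
`C_j = e_j(insert a s)` (the full system), so `C_{j+1} = E_{j+1} + x_a E_j`.  The canonical
occupation of `a` at pair number `M + 1` is `P_a(M+1) = x_a E_M / C_{M+1}`. -/

/-- LOWER product form: `E_M · (C_{M+1} + x_a C_M) ≥ C_M · C_{M+1}`; equivalently
`P_a(M+1) ≥ x_a z₋ / (1 + x_a z₋)` with `z₋ = C_M / C_{M+1}`.  The defect is
`x_a (E_M² - E_{M-1} E_{M+1}) ≥ 0`. [new] -/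
theorem occupation_lower_prodForm {x : α → ℝ} {s : Finset α} (hx : ∀ k ∈ s, 0 ≤ x k) {a : α}
    (ha : a ∉ s) (hxa : 0 ≤ x a) (M : ℕ) :
    esy[x, insert a s, M] * esy[x, insert a s, M + 1] ≤
      esy[x, s, M] * (esy[x, insert a s, M + 1] + x a * esy[x, insert a s, M]) := by
  cases M with
  | zero =>
    rw [esy_zero, esy_zero, one_mul, one_mul]
    have := esy_nonneg (s := insert a s) (fun k hk => ?_) 1 (x := x)
    · nlinarith [this]
    · rcases mem_insert.1 hk with rfl | hk
      · exact hxa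
      · exact hx k hk
  | succ m =>
    rw [esy_insert_succ x ha (m + 1), esy_insert_succ x ha m]
    have h := esy_mul_esy_le_sq hx m
    have hE := esy_nonneg hx (x := x)
    nlinarith [h, mul_le_mul_of_nonneg_left h hxa, hE m, hE (m + 1), hE (m + 2)]

/-- UPPER product form: `E_M · (C_{M+2} + x_a C_{M+1}) ≤ C_{M+1}²`; equivalently
`P_a(M+1) ≤ x_a z₊ / (1 + x_a z₊)` with `z₊ = C_{M+1} / C_{M+2}`.  The defect is
`E_{M+1}² - E_M E_{M+2} ≥ 0`. [new] -/
theorem occupation_upper_prodForm {x : α → ℝ} {s : Finset α} (hx : ∀ k ∈ s, 0 ≤ x k) {a : α}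
    (ha : a ∉ s) (M : ℕ) :
    esy[x, s, M] * (esy[x, insert a s, M + 2] + x a * esy[x, insert a s, M + 1]) ≤
      esy[x, insert a s, M + 1] ^ 2 := by
  rw [esy_insert_succ x ha (M + 1), esy_insert_succ x ha M]
  have h := esy_mul_esy_le_sq hx M
  have e1 : M + 1 + 1 = M + 2 := by ring
  rw [e1]
  nlinarith [h]

/-- The two fugacities are ordered: `z₋ = C_M/C_{M+1} ≤ z₊ = C_{M+1}/C_{M+2}`, in product form
`C_M C_{M+2} ≤ C_{M+1}²`. [folklore] -/
theorem fugacity_lower_le_upper_prodForm {x : α → ℝ} {s : Finset α} (hx : ∀ k ∈ s, 0 ≤ x k)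
    (M : ℕ) : esy[x, s, M] * esy[x, s, M + 2] ≤ esy[x, s, M + 1] ^ 2 :=
  esy_mul_esy_le_sq hx M

/-- OCCUPATION SANDWICH, lower half (division form): the canonical occupation of mode `a` at
pair number `M + 1` is at least the grand-canonical occupation at fugacity
`z₋ = C_M / C_{M+1}`:  `x_a C_M / (C_{M+1} + x_a C_M) ≤ x_a E_M / C_{M+1}`. [new] -/
theorem occupation_ge {x : α → ℝ} {s : Finset α} (hx : ∀ k ∈ s, 0 ≤ x k) {a : α}
    (ha : a ∉ s) (hxa : 0 ≤ x a) (M : ℕ) (hC : 0 < esy[x, insert a s, M + 1]) :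
    x a * esy[x, insert a s, M] / (esy[x, insert a s, M + 1] + x a * esy[x, insert a s, M]) ≤
      x a * esy[x, s, M] / esy[x, insert a s, M + 1] := by
  have hxs' : ∀ k ∈ insert a s, 0 ≤ x k := fun k hk => by
    rcases mem_insert.1 hk with rfl | hk
    · exact hxa
    · exact hx k hk
  have hCM : 0 ≤ esy[x, insert a s, M] := esy_nonneg hxs' M
  have hden : 0 < esy[x, insert a s, M + 1] + x a * esy[x, insert a s, M] :=
    add_pos_of_pos_of_nonneg hC (mul_nonneg hxa hCM)
  rw [div_le_div_iff₀ hden hC]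
  have h := occupation_lower_prodForm hx ha hxa M
  nlinarith [mul_le_mul_of_nonneg_left h hxa]

/-- OCCUPATION SANDWICH, upper half (division form): the canonical occupation of mode `a` at
pair number `M + 1` is at most the grand-canonical occupation at fugacity
`z₊ = C_{M+1} / C_{M+2}`:  `x_a E_M / C_{M+1} ≤ x_a C_{M+1} / (C_{M+2} + x_a C_{M+1})`. [new] -/
theorem occupation_le {x : α → ℝ} {s : Finset α} (hx : ∀ k ∈ s, 0 ≤ x k) {a : α}
    (ha : a ∉ s) (hxa : 0 ≤ x a) (M : ℕ) (hC : 0 < esy[x, insert a s, M + 1]) :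
    x a * esy[x, s, M] / esy[x, insert a s, M + 1] ≤
      x a * esy[x, insert a s, M + 1] /
        (esy[x, insert a s, M + 2] + x a * esy[x, insert a s, M + 1]) := by
  have hxs' : ∀ k ∈ insert a s, 0 ≤ x k := fun k hk => by
    rcases mem_insert.1 hk with rfl | hk
    · exact hxa
    · exact hx k hk
  rcases hxa.eq_or_lt with h0 | hpos
  · rw [← h0, zero_mul, zero_mul, zero_div, zero_div]
  have hden : 0 < esy[x, insert a s, M + 2] + x a * esy[x, insert a s, M + 1] :=
    add_pos_of_nonneg_of_pos (esy_nonneg hxs' (M + 2)) (mul_pos hpos hC)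
  rw [div_le_div_iff₀ hC hden]
  have h := occupation_upper_prodForm hx ha M
  nlinarith [mul_le_mul_of_nonneg_left h hxa]

end Summit.HubbardSuperconductivity.HubbardSuperconductivity.Theorems.CanonicalOccupation
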